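import Mathlib
import HarnessLib
import HarnessLib.Audit
import Summits.Parity.Statement
import Literature.NumberTheory.Sieve.MoebiusShiftedPrimes

/-!
Route: ShiftedMultiplicationTable

CLOSED (retired) 2026-08-15T13:50:41Z by operator:999:1257524 — reason: not-a-thesis: assembly does not conclude the sub-problem Statement — note: D-0027 §2.1 audit (human 2026-08-15: routes that do not decide the summit are removed): the assembly concludes `MobiusDilatedShiftedPrimes`, not the sub-problem statement; a NEW conforming route may be opened from the same idea (generated `closes : … → _root_.GeneralizedHardyLittlewood`).. The file is kept as the record of this route; refuted decls are indexed as negative knowledge (`ledger negatives`).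

# Route ShiftedMultiplicationTable — Liouville is not near rank one on shifted multiplication tables
— a main-term-free Type-II input for μ at shifted primes

It suffices — for the parity atom shared with route MobiusShiftedPrimes (stmt-Parity-0612: μ is
orthogonal to the dilated shifted primes, ∑_{d≤x} μ(d)Λ(dm+h) = o(x) for all m, h ≥ 1, whose m = 1
case is the folklore conjecture Literature.NumberTheory.Sieve.MoebiusShiftedPrimesConjecture) — to
show X = X1 ∧ X2 (card shifted-multiplication-table-norm, with the normalisation corrected). X1
(RectangleChowla): for every shift c ≠ 0 the Liouville matrix M_c = (λ(ab+c))_{a∼A, b≤x/A} has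
fourth moment tr(M_cM_cᵀ)² = ∑_{a,a'∼A} (∑_b λ(ab+c)λ(a'b+c))² ≤ x²(log x)^{-C} for every C,
uniformly for A in the Type-II window [x^δ, x^{1/3+δ}] — "λ on the shifted multiplication table is
not close to a rank-one matrix", ‖M_c‖_op ≤ (A·x/A)^{1/2}(log x)^{-C/4}; equivalently two-point
Chowla for λ holds with a log-power saving on average over the rank-one family of progressions
(modulus aa', residue ac, shift (a'−a)c). X2 (TypeI2Liouville): λ is equidistributed in the fixed
class c over the bilinear moduli q·r, q summed smoothly, r ≤ x^ρ with absolute values, at total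
level x^{1/2+ρ} for SOME ρ > 0 (the Liouville analogue of Bombieri–Friedlander–Iwaniec 1986 Theorem
9; its r = 1 case is Drappeau–Topacogullari 2019). Decomposing the PRIME by Heath-Brown's identity
and keeping λ whole, X1 is the Type-II input, X2 the Type-I₂ input, Bombieri–Vinogradov for λ
(known) the Type-I input; the output has no main term and no singular series.
Lean: `(∀ c : ℤ, c ≠ 0 → ∀ δ : ℝ, 0 < δ → ∀ C : ℝ, 0 < C → ∃ x₀ : ℝ, ∀ x : ℝ, x₀ ≤ x → ∀ A : ℝ, x ^
δ ≤ A → A ≤ x ^ (1 / 3 + δ) → (∑ a ∈ Finset.Ioc ⌊A⌋₊ ⌊2 * A⌋₊, ∑ a' ∈ Finset.Ioc ⌊A⌋₊ ⌊2 * A⌋₊, (∑ b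
∈ Finset.Icc 1 ⌊x / A⌋₊, (ArithmeticFunction.liouville (Int.toNat ((a : ℤ) * b + c)) : ℝ) *
(ArithmeticFunction.liouville (Int.toNat ((a' : ℤ) * b + c)) : ℝ)) ^ 2) ≤ x ^ 2 / Real.log x ^ C) ∧
(∀ c : ℤ, c ≠ 0 → ∀ m : ℕ, 1 ≤ m → ∃ ρ : ℝ, 0 < ρ ∧ ∀ A : ℝ, 0 < A → ∃ C x₀ : ℝ, ∀ x : ℝ, x₀ ≤ x → ∀
R Q y : ℝ, 1 ≤ R → R ≤ x ^ ρ → 0 ≤ Q → Q * R ≤ x ^ (1 / 2 + ρ) → 0 ≤ y → y ≤ x → ∀ u v : ℕ, (∑ r ∈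
Finset.Icc 1 ⌊R⌋₊, |∑ q ∈ (Finset.Icc 1 ⌊Q⌋₊).filter (fun q : ℕ => q ≡ u [MOD m]), ∑ n ∈ (Finset.Icc
1 ⌊y / (q * r)⌋₊).filter (fun n : ℕ => n ≡ v [MOD m]), (ArithmeticFunction.liouville (Int.toNat ((q
: ℤ) * r * n + c)) : ℝ)|) ≤ C * x / Real.log x ^ A)`

## Assembly
Pure logic from the two glue lemmas: SieveReduction turns RectangleChowla ∧ TypeI2Liouville ∧
BVLiouville into log-power cancellation of λ(n+c) against Λ(n) along every fixed progression;
LiouvilleToMobius converts that (squarefree sieve in k ≤ K, complete multiplicativity,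
Brun–Titchmarsh tail) into the Möbius statement 0612 for all dilations m and shifts h (and into
MoebiusShiftedPrimesConjecture). Continuation beyond this route (not items): uniformity in m ≤ x^ε
(a rectangle Chowla along sub-progressions a ≡ u, b ≡ v (mod m), m ≤ x^ε, same rank-one shape)
upgrades 0612 to M_avg = stmt-Parity-0613; route MobiusShiftedPrimes' Assembly (stmt-Parity-0611,
provable) gives EH ∧ M_avg(h=2) ⟹ ∑Λ(n)Λ(n+2) ∼ 𝔖x; tuples and DicksonFibration.Assembly (DimOne →
GHL) carry Hardy–Littlewood to Summit.Parity.GeneralizedHardyLittlewood. So X ⟹ the parity half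
unconditionally; X ∧ EH(+tuple analogues) ⟹ the GHL conjunct.

Rationale: WHY THIS LINE. Harman (Prime-Detecting Sieves §14.2, PDF p.286) and Polymath 8b (§8) locate the
whole difficulty of μ/λ at p+2 in ONE missing input: Type-II (bilinear) information for the shifted
primes; Ford–Maynard (arXiv:2407.14368) prove that some Type-II window is necessary. The card's move
is to decompose the prime (Heathbrown1982) and keep λ whole — the architecture of Pitt's cusp-form
Titchmarsh theorem (doi:10.1090/s0894-0347-2012-00750-4), where GL(2) supplies the bilinear estimate
by the spectral large sieve — so that the parity-breaking bilinear object ∑ α_a β_b λ(ab+c) carries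
no main term, and to identify the needed estimate with an operator norm, hence (‖M‖_op⁴ ≤ tr(MMᵀ)²)
with Liouville cancellation on the rank-one 4-point pattern {ab+c, a'b+c, ab'+c, a'b'+c}, a
configuration that is a fixed point of Cauchy–Schwarz and trivial exactly at c = 0. Imported areas:
random-matrix/operator-norm bookkeeping (linear algebra), the dispersion method for the Type-I₂
corner (BombieriFriedlanderIwaniecActa1986 Thm 9; doi:10.2140/ant.2019.13.2383 for λ at r = 1), and
— as the intended ENGINE for X1, not as a hypothesis — q-aspect Matomäki–Radziwiłł technology
(MatomakiRadziwillTao2015, doi:10.1112/plms.12546) read on the rank-one family. Relative to route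
MobiusShiftedPrimes (which files 0612/0613 with no engine) this route sits one level below with a
provable reduction; relative to the negatives index (empty for Parity) nothing is re-asked.
Correction to the card made here: an o(1) operator-norm saving does NOT suffice (Cauchy–Schwarz
loses the density of prime-supported or divisor-bounded coefficients, a factor (log x)^{1/2}…(log
x)^C), so X1 is filed with a log-power saving; and the window must contain 1/3 (three smooth
variables of size x^{1/3} are otherwise the level-2/3 wall), so it is [x^δ, x^{1/3+δ}].

RANKED CRUXES. #2 RectangleChowla (crux) — Card Crux 1, log-power form. For every c ≠ 0, δ > 0, C >
0 and all large x, uniformly for x^δ ≤ A ≤ x^{1/3+δ}: ∑_{a,a' ∈ (A,2A]} (∑_{b ≤ x/A} λ(ab+c)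
λ(a'b+c))² ≤ x²/(log x)^C (trivial bound ≍ x²; diagonal a = a' contributes x²/A ≤ x^{2−δ}; random
model ≍ x·A). Equivalent forms: tr(M_cM_cᵀ)² ≤ A²B²(log x)^{-C} with B = x/A; two-point Chowla ∑_{n
≡ ac (aa'), n ≤ aa'B} λ(n)λ(n+(a'−a)c) = small on average over (a,a') (multiply by λ(a)λ(a')). A
fixed large C (≈ 40, from the Heath-Brown bookkeeping) already suffices for the Assembly; the o(1)
version is the natural first waypoint but is not known to suffice. [difficulty: open-problem] (why
it might fail: Needs a (log x)^{-C} saving, ∀C, in a 2-point Chowla average over a COUPLED (modulus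
aa', residue ac, shift (a'−a)c) family of density A⁻² among (q,r) pairs: q-aspect MR (KMT) is
1-point, almost-all q, ε-savings; even log-averaged 2-point Chowla has far weaker rates.)
[MatomakiRadziwillTao2015, doi:10.1112/plms.12546, Tao2016, Harman2007, Polymath8b2014,
Literature.Barriers.Parity.Polymath2014_liouvillePairAP]
#3 TypeI2Liouville (crux) — Card Crux 2, made precise as the Liouville analogue of BFI 1986 Theorem
9 at level just above 1/2: for every c ≠ 0 and auxiliary modulus m ≥ 1 there is ρ > 0 such that for
every A, all large x, all 1 ≤ R ≤ x^ρ, Q ≥ 0 with QR ≤ x^{1/2+ρ}, 0 ≤ y ≤ x and classes u, v mod m: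
∑_{r ≤ R} |∑_{q ≤ Q, q ≡ u (m)} ∑_{n ≤ y/(qr), n ≡ v (m)} λ(qrn + c)| ≤ C x/(log x)^A. Here m = 1 is
the essential case (the classes u, v are bookkeeping so that the sieve glue can use the statement
black-box for congruence-restricted prime sums); for QR ≤ x^{1/2−ε} it is Bombieri–Vinogradov for λ;
the open content is the strip x^{1/2−ε} < QR ≤ x^{1/2+ρ} with the smooth q-sum — for R = 1 this is
in print (Drappeau–Topacogullari 2019, Thm 1.1–1.3: λ ∈ 𝓕₁(1), 'Bombieri–Vinogradov beyond √x
without absolute values in a fixed class'; μ = τ_{−1}), for Λ in place of λ it is BFI Theorem 9 (R <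
x^{1/10−ε}, QR < x(log x)^{-B}). [difficulty: L] (why it might fail: R=1 is Drappeau–Topacogullari
2019; the r≤x^ρ extension with absolute values needs BFI §16 (Theorems 6, 7*, Deshouillers–Iwaniec)
redone for λ, whose uniformity D–T flag as delicate; if only ρ=0 is available the smalls r<x^δ of
the Heath-Brown decomposition are not absorbed.) [BombieriFriedlanderIwaniecActa1986,
doi:10.2140/ant.2019.13.2383, doi:10.1090/memo/1542, FordMaynard2024PrimeSieves,
Literature.NumberTheory.Sieve.BombieriFriedlanderIwaniecTheorem5Star]
#9 BVLiouville (support) — Bombieri–Vinogradov for the Liouville function at level x^{1/2−ε} with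
absolute values, one arbitrary residue c_d ∈ [0,d) and height y_d ≤ x per modulus: ∑_{d ≤ x^{1/2−ε}}
|∑_{n ≤ y_d/d} λ(dn + c_d)| ≤ C x/(log x)^A. Known theorem; provable now from in-tree inputs:
Heath-Brown's identity (Literature.NumberTheory.Sieve.HeathBrown.heathBrown_identity, proved) for λ
= μ ⋆ 1_□, the bilinear large-sieve theorem BFI Theorem 0(b)
(Literature.NumberTheory.Sieve.BombieriFriedlanderIwaniecTheorem0b_holds, proved) and Siegel–Walfisz
for λ (Literature.NumberTheory.LFunctions.SiegelWalfiszMoebius_holds, .liouville_progression,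
proved). [difficulty: L] [BombieriFriedlanderIwaniecActa1986, IwaniecKowalski2004, Vaughan1980]
#9 BilinearFromRectangle (support) — The operator-norm step: RectangleChowla → for all real
coefficients α, β: |∑_{a∼A} ∑_{b≤x/A} α_a β_b λ(ab+c)| ≤ ‖α‖₂ ‖β‖₂ x^{1/2} (log x)^{-C} for every C,
uniformly for A in the window (‖M‖_op⁴ ≤ ‖MᵀM‖²_HS = tr(MMᵀ)² = the crux's fourth moment;
finite-dimensional linear algebra, Mathlib Matrix API). [difficulty: provable-now] [Harman2007,
IwaniecKowalski2004]
#9 SieveReduction (support) — The sieve glue (sizable but standard): RectangleChowla →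
TypeI2Liouville → (Bombieri–Vinogradov for λ, inlined) → for every modulus m ≥ 1, class w, shift c ≠
0 and A: |∑_{n ≤ x, n ≡ w (m)} Λ(n) λ(n+c)| ≤ C x/(log x)^A. Proof plan: Heath-Brown's identity with
K = 3 on Λ (in tree), dyadic localisation of all variables and of the total product; with δ₁ = ρ/3:
a partial product in [x^{δ₁}, x^{1/3+δ₁}] ∪ [x^{2/3}, x^{1−δ₁}] ⇒ Type II via BilinearFromRectangle
(hyperbolic cut ab ≤ x removed by (log x)^{C'}-fine subdivision; classes mod m by restricting
coefficients); otherwise the smalls have product r < x^{δ₁} and at most two smooth variables exceed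
x^{1/3}: one of them ≥ x^{1/2+2δ₁} ⇒ Type I (modulus ≤ x^{1/2−δ₁}, BV for λ with moduli dm); else
both lie in [x^{1/2−3δ₁}, x^{1/2+2δ₁}] ⇒ Type I₂ with moduli r·n₁ ≤ x^{1/2+3δ₁} (localise the total
product, not n₂, so heights are uniform) ⇒ TypeI2Liouville. Log weights by partial summation; pieces
of total size ≤ x^{1−δ₁/10} trivially. [difficulty: XL] [Heathbrown1982, Harman2007,
BombieriFriedlanderIwaniecActa1986, FordMaynard2024PrimeSieves]
#9 LiouvilleToMobius (support) — From Liouville to Möbius along dilated shifted primes: the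
conclusion of SieveReduction (all m, w, c) implies stmt-Parity-0612 (∑_{d≤x} μ(d)Λ(dm+h) = o(x) ∀
m,h ≥ 1) and Literature.NumberTheory.Sieve.MoebiusShiftedPrimesConjecture (∑_{p≤X} μ(p+h) =
o(π(X))). Proof plan: μ(n) = λ(n)∑_{k²∣n} μ(k) (in tree: moebius_eq_sum_sq_dvd), λ((p−h)/m) =
λ(m)λ(p−h) when m ∣ p−h (complete multiplicativity), so ∑_d μ(d)Λ(dm+h) = λ(m) ∑_{k ≤ K} μ(k) ∑_{p ≤
xm+h, p ≡ h (mk²)} Λ(p) λ(p−h) + O(x·(m/φ(m))/K) by Brun–Titchmarsh (or the trivial bound) for the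
tail; each k-term is o(x) by the hypothesis with (mk², h mod mk², c = −h); let K → ∞;
π-normalisation by partial summation, prime powers O(√x). [difficulty: M] [Lichtman2020,
MurtyVatwani2017, Literature.NumberTheory.Sieve.MoebiusShiftedPrimesConjecture]
#9 MobiusDilatedShiftedPrimes (support) — Terminal node (identical to stmt-Parity-0612, crux r2 of
route MobiusShiftedPrimes, shared by signature): for all m, h ≥ 1, ∑_{d ≤ x} μ(d) Λ(dm + h) = o(x).
This route does not attack it directly; its Assembly delivers it from the two cruxes. Filed here so
that a refutation of 0612 breaks this route too. [difficulty: open-problem]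
[Literature.NumberTheory.Sieve.MoebiusShiftedPrimesConjecture, Lichtman2020, Harman2007]

TWO-LAYER PLAN. Foreseen glued splits (k ≤ 3, depth 1), filed only when a crux closes or stalls with
a census: RectangleChowla ⇐ PretentiousCase (pairs (a,a') and scales where λ restricted to the
progression ac mod aa' is exceptional in the KMT sense: large-sieve / Halász count of exceptional
(aa', t)) → GenericCase (q-aspect Matomäki–Radziwiłł on the rank-one family with a log-power saving)
→ RectangleChowla; TypeI2Liouville ⇐ SmoothStrip (R = 1, x^{1/2−ε} < Q ≤ x^{1/2+ρ}:
Drappeau–Topacogullari for λ, to be vendored as a Literature fact) → RoughFactor (absolute values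
over r ≤ x^ρ: BFI §16 for λ) → TypeI2Liouville; SieveReduction ⇐ HeathBrownCasework →
TypeIITreatment → SieveReduction.

KILL CRITERIA. RectangleChowla REFUTED for some (c, δ, C) — e.g. a structured lower bound
tr(M_cM_cᵀ)² ≫ x²/(log x)^{C₀} from an unforeseen algebraic family of pairs (a,a') — closes the
route (`close --reason refuted:RectangleChowla`) unless the witness only kills the ∀C form, in which
case restate with the fixed exponent C₀ = 40 the Assembly actually uses (pivot). TypeI2Liouville
refuted (implausible: it sits below GRH-strength distribution claims for λ) ⇒ pivot to the
Crux-2-free variant: RectangleChowla on the wider window A ≤ x^{1/2} (balanced tables; then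
Vaughan's identity needs no Type I₂). stmt-Parity-0612 refuted ⇒ both this route and
MobiusShiftedPrimes break; the refuting (m,h) localises which crux is false via the proved glue.
Route is MOOT (close superseded) if 0612 is proved by other means.

NOT DECOMPOSED YET. The m ≤ x^ε-uniform rectangle Chowla (sub-progression tables) and the upgrade
0612 → 0613 (M_avg) — layer 2, after RectangleChowla moves; the o(1) (card) form of Crux 1 as a
stepping stone; the balanced window A ∈ [x^{1/3}, x^{1/2}] (alternative to Crux 2, a different route
if ever filed); vendoring Drappeau–Topacogullari Thm 1.2 and BFI Theorems 6/7*/9 as Literature facts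
(cite requests below); the EH half and everything above HL pairs (tuples, DimOne → GHL) — owned by
routes MobiusShiftedPrimes and DicksonFibration; effective/explicit constants (all constants here
are Siegel-ineffective).

CHEAPEST FALSIFIER. (i) Logic, one page: does RectangleChowla (log-power, A = x^{1/3}) imply binary
Chowla ∑_{n≤x} λ(n)λ(n+1) = o(x) by a short argument? If yes the crux is not easier than Chowla and
the route should be regraded 'reformulation' (triage refuter: no — one residue ac per modulus aa',
logically incomparable). (ii) Numerics (kit, when available): s₁(M_c)/(√A+√B) for A = x^{0.3}, B =
x/A, x = 10⁶…10⁸ and c ∈ {±1, 2}; the square-root-laws card measured 0.97–1.00 up to AB ≈ 5·10⁵ —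
any upward drift like (AB)^η warns, though numerics cannot see log powers. (iii) Lookup: is the
r-extension of Drappeau–Topacogullari / BFI Thm 9 for λ already in print (Fouvry–Radziwiłł
'unbalanced convolutions', Drappeau 2015–17 dispersion papers, Maynard Mem. AMS 2025 I §§7–8)? If
yes, TypeI2Liouville is support and the route is UNDER FLOOR (one crux) — then re-file as a
conditional split under MobiusShiftedPrimes rather than keep a one-crux route.

NUMBERS. Type-I level for λ: 1/2 (BV; in-tree ingredients proved: BFI Thm 0(b), Siegel–Walfisz for
μ/λ, Heath-Brown identity). BFI 1986 Thm 9 (Λ): R < x^{1/10−ε}, QR < x(log x)^{-B}; Thm 10: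
well-factorable level 4/7; Maynard 2025 I Thm 1.1 (Λ, absolute values over q₁q₂): Q₁Q₂² <
x^{1−100ε}, Q₁¹²Q₂⁷ < x^{4−100ε} — does NOT cover (√x)·(x^δ) with absolute values on both, hence the
smooth q-sum in Crux 2. Drappeau–Topacogullari 2019: ∑_{1<n≤x} f(n)τ(n−1) for f ∈ 𝓕_D(A) with error
x(log x)^{-N}, shifts/scalings a, |h| ≤ x^δ (Thm 1.2), μ = τ_{−1} all main-term coefficients vanish
(Thm 1.3). Ford–Maynard: with Type I at γ = 1/2−ε and Type II on [δ, 1/3] only, (γ,θ,ν) = (1/2−ε, δ,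
1/3−δ) has γ ∉ [θ,θ+ν], γ < 1−θ−ν = 2/3 ⇒ C⁻ = 0 (Thm 4.16 as vendored): Type I₂ is load-bearing.
Numerics (card square-root-laws-parity-objects, x ≤ 2·10⁶): s₁(λ-table) vs √A+√B vs trivial √(AB):
(A,B,c) = (300,300,1): 34.26 / 34.64 / 300; (40,12000,1): 115.94 / 115.87 / 692.8; (25,18000,1):
138.80 / 139.16 / 670.8; (90,5000,−7): 80.08 / 80.20 / 670.8 — Bai–Yin edge, no planted low-rank
part (s₂ matches random). Items at open: 8 (2 cruxes, 5 support, 1 assembly).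

DEFINITION REQUESTS. None for Lean notions (ArithmeticFunction.liouville/moebius/vonMangoldt are
Mathlib). Cite facts wanted (filed as cite items): Drappeau–Topacogullari 2019 Thm 1.2
(doi:10.2140/ant.2019.13.2383, arXiv:1807.09569 pp.3–5) for f = λ; BFI 1986 Theorems 6, 7*, 9 (Acta
Math. 156, §1 p.209 and §16) — the tree vendors Theorems 1, 2, 5, 5*, 10 only.

Novelty: Searches (2026-08-15, this planner; local search daemon and galaxy-pdf were down/saturated,
recorded): lit search --source crossref "Titchmarsh divisor problem multiplicative functions
combinatorial identities" (8; → doi:10.2140/ant.2019.13.2383 READ pp.3–5), "Pitt analogue of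
Titchmarsh divisor problem cusp forms" (→ doi:10.1090/s0894-0347-2012-00750-4), "multiplicative
functions in short arithmetic progressions" (→ doi:10.1112/plms.12546), "Möbius function arithmetic
progressions large moduli dispersion fixed residue" (→ doi:10.1090/memo/1542 READ Thm 1.1/Cor
1.2–1.4, BombieriFriedlanderIwaniecActa1986 READ p.209 Thms 8–10); lit search --source zbmath
"Liouville function shifted products ab+1 bilinear forms" (0), "Chowla conjecture along arithmetic
progressions average over moduli" (0); lit galaxy search --star all "multiplication table Liouville
operator norm" (panama 0, crabby 0, pdf unavailable); lit frontier Parity --since 2021 (30 rows,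
none on λ along shifted products); plus the card's searches (2026-08-15) and the triage refuter's
prior-art list. In-tree: lean search liouville (Mathlib ArithmeticFunction.liouville; Literature
Polymath2014_liouvillePairAP is the pointwise level-(1−ε) conjecture of which Crux 1 is a
rank-one-family average).
Nearest prior art found: doi:10.1090/s0894-0347-2012-00750-4 (Pitt 2013: decompose Λ, keep the GL(2)
coefficient whole, power saving via the spectral large sieve — the architecture);
doi:10.2140/ant.2019.13.2383 (Drappeau–Topacogul  [refs: 10.2140/ant.2019.13.2383, 10.1090/s0894-0347-2012-00750-4, 10.1112/plms.12546, 10.1090/memo/1542, doi:10.2140/ant.2019.13.2383, doi:10.1090/s0894-0347-2012-00750-4, doi:10.1112/plms.12546, doi:10.1090/memo/1542, BombieriFriedlanderIwaniecActa1986, MatomakiRadziwillTao2015, Harman2007, Lichtman2020]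

Barriers (technique_class: type-II bilinear-forms dispersion operator-norm): - technique_class: type-II bilinear-forms dispersion operator-norm
- Literature.Barriers.Parity.FordMaynardMinimalTypeII: respected, not evaded — the route SUPPLIES a
Type-II window [x^δ, x^{1/3+δ}] (RectangleChowla) of width 1/3 > ν₀, precisely because some window
is necessary at Type-I level < 1; a_n = λ(n+c) is signed, so the relevant half is FM Thm 2.2
(asymptotics), which the Heath-Brown casework meets by adding Type I₂.
- Literature.Barriers.Parity.FordMaynardLowLevel: with BV only (γ = 1/2−ε) and Type II on [δ, 1/3],
(γ,θ,ν) = (1/2−ε, δ, 1/3−δ) satisfies γ ∉ [θ,θ+ν], γ < 1−θ−ν, so C⁻ = 0 and Type I/II alone cannot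
close; the route exits the framework through TypeI2Liouville (trilinear 'Type I_j' information,
which FM §4.6 list as 'not covered by our setup') — this is why Crux 2 is a crux and not glue.
- Literature.Barriers.Parity.SelbergParityBarrier: Type-I data of any level leave ∑_p λ(p+c)
undetermined (Bombieri's indeterminacy); the route's decisive input is bilinear and parity-SENSITIVE
(it fails for Selberg's ghost 1+λ and for small-conductor pretenders χ, whose rectangle sums are ≍
B/q), so the barrier's technique class (type-I, level-of-distribution) is not the route's.
- Literature.Barriers.Parity.PrimePairParity: the weight-insertion test — inserting ω = 1 −
λ(n)λ(n+2) destroys the product structure λ(ab+c) (ω is not a function of ab+c), so the deduction is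
not weight-insertion invariant; it is an instance of the 'bilinear expressions' exit Polymath name;
the

History (route lifecycle, newest last):
- 2026-08-15T13:31:35Z · BROKEN — RectangleChowla (stmt-Parity-4218, crux) refuted by Summit.Parity.GeneralizedHardyLittlewood.Theorems.ShiftedMultiplicationTableRectangleChowla_refuted @ 002241d41fff (refuter-rreview-route-AtomisticToContinu-b24c46f1-0)
- 2026-08-15T13:50:42Z · CLOSED retired — not-a-thesis: assembly does not conclude the sub-problem Statement (operator:999:1257524)

sub-problem: GeneralizedHardyLittlewood · status: closed(retired) · opened planner-plancard-Parity-GeneralizedHardyLittl-d0e737d2-0 2026-08-15T11:29:55Z · rev 0 · ledger route-Parity-ShiftedMultiplicationTable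
GENERATED by the gate from the ledger (D-0016/17). Provers cite these decls: `theorem foo : Summit.Parity.GeneralizedHardyLittlewood.Theses.ShiftedMultiplicationTable.<Decl> := …` in Summits/Parity/GeneralizedHardyLittlewood/Theorems/<Name>.lean.
-/

namespace Summit.Parity.GeneralizedHardyLittlewood.Theses.ShiftedMultiplicationTable

open scoped BigOperators Topology Manifold Classical MeasureTheory ProbabilityTheory Matrix InnerProductSpace ComplexConjugate ContinuousMap
open Filter Set Function TopologicalSpace MeasureTheory

attribute [summit_statement] _root_.GeneralizedHardyLittlewood

/-- item stmt-Parity-4218 · crux · rank 2 · closed · refuted by Summit.Parity.GeneralizedHardyLittlewood.Theorems.ShiftedMultiplicationTableRectangleChowla_refuted @ 002241d41fff (refuter) · by planner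
why it might fail: Needs a (log x)^{-C} saving, ∀C, in a 2-point Chowla average over a COUPLED (modulus aa', residue ac, shift (a'−a)c) family of density A⁻² among (q,r) pairs: q-aspect MR (KMT) is 1-point, almost-all q, ε-savings; even log-averaged 2-point Chowla has far weaker rates.
sources: MatomakiRadziwillTao2015, doi:10.1112/plms.12546, Tao2016, Harman2007, Polymath8b2014, Literature.Barriers.Parity.Polymath2014_liouvillePairAP
[crux] Card Crux 1, log-power form. For every c ≠ 0, δ > 0, C > 0 and all large x, uniformly for x^δ
≤ A ≤ x^{1/3+δ}: ∑_{a,a' ∈ (A,2A]} (∑_{b ≤ x/A} λ(ab+c) λ(a'b+c))² ≤ x²/(log x)^C (trivial bound ≍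
x²; diagonal a = a' contributes x²/A ≤ x^{2−δ}; random model ≍ x·A). Equivalent forms: tr(M_cM_cᵀ)²
≤ A²B²(log x)^{-C} with B = x/A; two-point Chowla ∑_{n ≡ ac (aa'), n ≤ aa'B} λ(n)λ(n+(a'−a)c) =
small on average over (a,a') (multiply by λ(a)λ(a')). A fixed large C (≈ 40, from the Heath-Brown
bookkeeping) already suffices for the Assembly; the o(1) version is the natural first waypoint but
is not known to suffice. [difficulty: open-problem] -/
@[route_item "route-Parity-ShiftedMultiplicationTable"]
def RectangleChowla : Prop :=
  ∀ c : ℤ, c ≠ 0 → ∀ δ : ℝ, 0 < δ → ∀ C : ℝ, 0 < C → ∃ x₀ : ℝ, ∀ x : ℝ, x₀ ≤ x → ∀ A : ℝ, x ^ δ ≤ A → A ≤ x ^ (1 / 3 + δ) → (∑ a ∈ Finset.Ioc ⌊A⌋₊ ⌊2 * A⌋₊, ∑ a' ∈ Finset.Ioc ⌊A⌋₊ ⌊2 * A⌋₊, (∑ b ∈ Finset.Icc 1 ⌊x / A⌋₊, (ArithmeticFunction.liouville (Int.toNat ((a : ℤ) * b + c)) : ℝ) * (ArithmeticFunction.liouville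 (Int.toNat ((a' : ℤ) * b + c)) : ℝ)) ^ 2) ≤ x ^ 2 / Real.log x ^ C

/-- item stmt-Parity-4219 · crux · rank 3 · closed · moot by None · by planner
why it might fail: R=1 is Drappeau–Topacogullari 2019; the r≤x^ρ extension with absolute values needs BFI §16 (Theorems 6, 7*, Deshouillers–Iwaniec) redone for λ, whose uniformity D–T flag as delicate; if only ρ=0 is available the smalls r<x^δ of the Heath-Brown decomposition are not absorbed.
sources: BombieriFriedlanderIwaniecActa1986, doi:10.2140/ant.2019.13.2383, doi:10.1090/memo/1542, FordMaynard2024PrimeSieves, Literature.NumberTheory.Sieve.BombieriFriedlanderIwaniecTheorem5Star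
[crux] Card Crux 2, made precise as the Liouville analogue of BFI 1986 Theorem 9 at level just above
1/2: for every c ≠ 0 and auxiliary modulus m ≥ 1 there is ρ > 0 such that for every A, all large x,
all 1 ≤ R ≤ x^ρ, Q ≥ 0 with QR ≤ x^{1/2+ρ}, 0 ≤ y ≤ x and classes u, v mod m: ∑_{r ≤ R} |∑_{q ≤ Q, q
≡ u (m)} ∑_{n ≤ y/(qr), n ≡ v (m)} λ(qrn + c)| ≤ C x/(log x)^A. Here m = 1 is the essential case
(the classes u, v are bookkeeping so that the sieve glue can use the statement black-box for
congruence-restricted prime sums); for QR ≤ x^{1/2−ε} it is Bombieri–Vinogradov for λ; the open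
content is the strip x^{1/2−ε} < QR ≤ x^{1/2+ρ} with the smooth q-sum — for R = 1 this is in print
(Drappeau–Topacogullari 2019, Thm 1.1–1.3: λ ∈ 𝓕₁(1), 'Bombieri–Vinogradov beyond √x without
absolute values in a fixed class'; μ = τ_{−1}), for Λ in place of λ it is BFI Theorem 9 (R <
x^{1/10−ε}, QR < x(log x)^{-B}). [difficulty: L] -/
@[route_item "route-Parity-ShiftedMultiplicationTable"]
def TypeI2Liouville : Prop :=
  ∀ c : ℤ, c ≠ 0 → ∀ m : ℕ, 1 ≤ m → ∃ ρ : ℝ, 0 < ρ ∧ ∀ A : ℝ, 0 < A → ∃ C x₀ : ℝ, ∀ x : ℝ, x₀ ≤ x → ∀ R Q y : ℝ, 1 ≤ R → R ≤ x ^ ρ → 0 ≤ Q → Q * R ≤ x ^ (1 / 2 + ρ) → 0 ≤ y → y ≤ x → ∀ u v : ℕ, (∑ r ∈ Finset.Icc 1 ⌊R⌋₊, |∑ q ∈ (Finset.Icc 1 ⌊Q⌋₊).filter (fun q : ℕ => q ≡ u [MOD m]), ∑ n ∈ (Finset.Icc 1 ⌊y / (q * r)⌋₊).filter (fun n : ℕ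 => n ≡ v [MOD m]), (ArithmeticFunction.liouville (Int.toNat ((q : ℤ) * r * n + c)) : ℝ)|) ≤ C * x / Real.log x ^ A

/-- item stmt-Parity-0612 · support · rank 9 · closed · moot by None · by planner
sources: Literature.NumberTheory.Sieve.MoebiusShiftedPrimesConjecture, Lichtman2020, Harman2007
Atom (M_m,h): for all m ≥ 1, h ≥ 1: ∑_{d ≤ x} μ(d) Λ(dm + h) = o(x), i.e. the Möbius function of
(p-h)/m does not correlate with primality of p along p ≡ h (mod m). Open (parity-breaking); m = 1 is
'μ(p - h) has mean 0 over primes'. -/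
@[route_item "route-Parity-ShiftedMultiplicationTable"]
def MobiusDilatedShiftedPrimes : Prop :=
  ∀ m h : ℕ, 1 ≤ m → 1 ≤ h → (fun x : ℕ => ∑ d ∈ Finset.Icc 1 x, (ArithmeticFunction.moebius d : ℝ) * ArithmeticFunction.vonMangoldt (d * m + h)) =o[Filter.atTop] fun x : ℕ => (x : ℝ)

/-- item stmt-Parity-4220 · support · rank 9 · closed · moot by None · by planner
sources: BombieriFriedlanderIwaniecActa1986, IwaniecKowalski2004, Vaughan1980
[support] Bombieri–Vinogradov for the Liouville function at level x^{1/2−ε} with absolute values,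
one arbitrary residue c_d ∈ [0,d) and height y_d ≤ x per modulus: ∑_{d ≤ x^{1/2−ε}} |∑_{n ≤ y_d/d}
λ(dn + c_d)| ≤ C x/(log x)^A. Known theorem; provable now from in-tree inputs: Heath-Brown's
identity (Literature.NumberTheory.Sieve.HeathBrown.heathBrown_identity, proved) for λ = μ ⋆ 1_□, the
bilinear large-sieve theorem BFI Theorem 0(b)
(Literature.NumberTheory.Sieve.BombieriFriedlanderIwaniecTheorem0b_holds, proved) and Siegel–Walfisz
for λ (Literature.NumberTheory.LFunctions.SiegelWalfiszMoebius_holds, .liouville_progression,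
proved). [difficulty: L] -/
@[route_item "route-Parity-ShiftedMultiplicationTable"]
def BVLiouville : Prop :=
  ∀ ε : ℝ, 0 < ε → ∀ A : ℝ, 0 < A → ∃ C x₀ : ℝ, ∀ x : ℝ, x₀ ≤ x → ∀ c : ℕ → ℤ, ∀ y : ℕ → ℝ, (∀ d, 0 ≤ c d ∧ c d < d) → (∀ d, 0 ≤ y d ∧ y d ≤ x) → (∑ d ∈ Finset.Icc 1 ⌊x ^ (1 / 2 - ε)⌋₊, |∑ n ∈ Finset.Icc 1 ⌊y d / d⌋₊, (ArithmeticFunction.liouville (Int.toNat ((d : ℤ) * n + c d)) : ℝ)|) ≤ C * x / Real.log x ^ A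

/-- item stmt-Parity-4221 · support · rank 9 · closed · moot by None · by planner
sources: Harman2007, IwaniecKowalski2004
[support] The operator-norm step: RectangleChowla → for all real coefficients α, β: |∑_{a∼A}
∑_{b≤x/A} α_a β_b λ(ab+c)| ≤ ‖α‖₂ ‖β‖₂ x^{1/2} (log x)^{-C} for every C, uniformly for A in the
window (‖M‖_op⁴ ≤ ‖MᵀM‖²_HS = tr(MMᵀ)² = the crux's fourth moment; finite-dimensional linear
algebra, Mathlib Matrix API). [difficulty: provable-now] -/
@[route_item "route-Parity-ShiftedMultiplicationTable"]
def BilinearFromRectangle : Prop :=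
  RectangleChowla → ∀ c : ℤ, c ≠ 0 → ∀ δ : ℝ, 0 < δ → ∀ C : ℝ, 0 < C → ∃ x₀ : ℝ, ∀ x : ℝ, x₀ ≤ x → ∀ A : ℝ, x ^ δ ≤ A → A ≤ x ^ (1 / 3 + δ) → ∀ α β : ℕ → ℝ, |∑ a ∈ Finset.Ioc ⌊A⌋₊ ⌊2 * A⌋₊, ∑ b ∈ Finset.Icc 1 ⌊x / A⌋₊, α a * β b * (ArithmeticFunction.liouville (Int.toNat ((a : ℤ) * b + c)) : ℝ)| ≤ Real.sqrt (∑ a ∈ Finset.Ioc ⌊A⌋₊ ⌊2 * A⌋₊, α a ^ 2) * Real.sqrt (∑ b ∈ Finset.Icc 1 ⌊x / A⌋₊, β b ^ 2) * x ^ (1 / 2 : ℝ) / Real.log x ^ C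

/-- item stmt-Parity-4222 · support · rank 9 · closed · moot by None · by planner
sources: Heathbrown1982, Harman2007, BombieriFriedlanderIwaniecActa1986, FordMaynard2024PrimeSieves
[support] The sieve glue (sizable but standard): RectangleChowla → TypeI2Liouville →
(Bombieri–Vinogradov for λ, inlined) → for every modulus m ≥ 1, class w, shift c ≠ 0 and A: |∑_{n ≤
x, n ≡ w (m)} Λ(n) λ(n+c)| ≤ C x/(log x)^A. Proof plan: Heath-Brown's identity with K = 3 on Λ (in
tree), dyadic localisation of all variables and of the total product; with δ₁ = ρ/3: a partial
product in [x^{δ₁}, x^{1/3+δ₁}] ∪ [x^{2/3}, x^{1−δ₁}] ⇒ Type II via BilinearFromRectangle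
(hyperbolic cut ab ≤ x removed by (log x)^{C'}-fine subdivision; classes mod m by restricting
coefficients); otherwise the smalls have product r < x^{δ₁} and at most two smooth variables exceed
x^{1/3}: one of them ≥ x^{1/2+2δ₁} ⇒ Type I (modulus ≤ x^{1/2−δ₁}, BV for λ with moduli dm); else
both lie in [x^{1/2−3δ₁}, x^{1/2+2δ₁}] ⇒ Type I₂ with moduli r·n₁ ≤ x^{1/2+3δ₁} (localise the total
product, not n₂, so heights are uniform) ⇒ TypeI2Liouville. Log weights by partial summation; pieces
of total size ≤ x^{1−δ₁/10} trivially. [difficulty: XL] -/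
@[route_item "route-Parity-ShiftedMultiplicationTable"]
def SieveReduction : Prop :=
  RectangleChowla → TypeI2Liouville → (∀ ε : ℝ, 0 < ε → ∀ A : ℝ, 0 < A → ∃ C x₀ : ℝ, ∀ x : ℝ, x₀ ≤ x → ∀ c : ℕ → ℤ, ∀ y : ℕ → ℝ, (∀ d, 0 ≤ c d ∧ c d < d) → (∀ d, 0 ≤ y d ∧ y d ≤ x) → (∑ d ∈ Finset.Icc 1 ⌊x ^ (1 / 2 - ε)⌋₊, |∑ n ∈ Finset.Icc 1 ⌊y d / d⌋₊, (ArithmeticFunction.liouville (Int.toNat ((d : ℤ) * n + c d)) : ℝ)|) ≤ C * x / Real.log x ^ A) → ∀ m : ℕ, 1 ≤ m → ∀ w : ℕ, ∀ c : ℤ, c ≠ 0 → ∀ A : ℝ, 0 < A → ∃ C x₀ : ℝ, ∀ x : ℝ, x₀ ≤ x → |∑ n ∈ (Finset.Icc 1 ⌊x⌋₊).filter (fun n : ℕ => n ≡ w [MOD m]), ArithmeticFunction.vonMangoldt n * (ArithmeticFunction.liouville (Int.toNat ((n : ℤ) + c)) : ℝ)| ≤ C * x / Real.log x ^ A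

/-- item stmt-Parity-4223 · support · rank 9 · closed · moot by None · by planner
sources: Lichtman2020, MurtyVatwani2017, Literature.NumberTheory.Sieve.MoebiusShiftedPrimesConjecture
[support] From Liouville to Möbius along dilated shifted primes: the conclusion of SieveReduction
(all m, w, c) implies stmt-Parity-0612 (∑_{d≤x} μ(d)Λ(dm+h) = o(x) ∀ m,h ≥ 1) and
Literature.NumberTheory.Sieve.MoebiusShiftedPrimesConjecture (∑_{p≤X} μ(p+h) = o(π(X))). Proof plan:
μ(n) = λ(n)∑_{k²∣n} μ(k) (in tree: moebius_eq_sum_sq_dvd), λ((p−h)/m) = λ(m)λ(p−h) when m ∣ p−h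
(complete multiplicativity), so ∑_d μ(d)Λ(dm+h) = λ(m) ∑_{k ≤ K} μ(k) ∑_{p ≤ xm+h, p ≡ h (mk²)} Λ(p)
λ(p−h) + O(x·(m/φ(m))/K) by Brun–Titchmarsh (or the trivial bound) for the tail; each k-term is o(x)
by the hypothesis with (mk², h mod mk², c = −h); let K → ∞; π-normalisation by partial summation,
prime powers O(√x). [difficulty: M] -/
@[route_item "route-Parity-ShiftedMultiplicationTable"]
def LiouvilleToMobius : Prop :=
  (∀ m : ℕ, 1 ≤ m → ∀ w : ℕ, ∀ c : ℤ, c ≠ 0 → ∀ A : ℝ, 0 < A → ∃ C x₀ : ℝ, ∀ x : ℝ, x₀ ≤ x → |∑ n ∈ (Finset.Icc 1 ⌊x⌋₊).filter (fun n : ℕ => n ≡ w [MOD m]), ArithmeticFunction.vonMangoldt n * (ArithmeticFunction.liouville (Int.toNat ((n : ℤ) + c)) : ℝ)| ≤ C * x / Real.log x ^ A) → (∀ m h : ℕ, 1 ≤ m → 1 ≤ h → (fun x : ℕ => ∑ d ∈ Finset.Icc 1 x, (ArithmeticFunction.moebius d : ℝ) * ArithmeticFunction.vonMangoldt (d * m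 + h)) =o[Filter.atTop] fun x : ℕ => (x : ℝ)) ∧ Literature.NumberTheory.Sieve.MoebiusShiftedPrimesConjecture

/-- item stmt-Parity-4224 · assembly · rank 1 · closed · moot by None · by planner
sources: Harman2007, Heathbrown1982, Lichtman2020
[assembly] RectangleChowla → TypeI2Liouville → BVLiouville → MobiusDilatedShiftedPrimes (=
stmt-Parity-0612; composition of SieveReduction and LiouvilleToMobius, checked sorry-free as an
`example` in the planner's Sketch.lean given the two glue statements). -/
@[route_item "route-Parity-ShiftedMultiplicationTable"]
def Assembly : Prop :=
  RectangleChowla → TypeI2Liouville → BVLiouville → MobiusDilatedShiftedPrimes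

end Summit.Parity.GeneralizedHardyLittlewood.Theses.ShiftedMultiplicationTable
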